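import Summits.CriticalPhenomena.SAWScalingLimit.Theses.SAWZoomRigidity
import HarnessLib

/-!
# `Assembly2` (route SAWZoomRigidity, item stmt-CriticalPhenomena-8331) — proved

The assembly item `Assembly2` of route SAWZoomRigidity is the uncurried form

`(Rigidity ∧ ZoomRigidity ∧ SubseqLimitAxioms ∧ JointCompactness ∧ ZoomInvariantLimitSet) →
SAWScalingLimit`

of the route's deciding theorem
`Summit.CriticalPhenomena.SAWScalingLimit.Theses.SAWZoomRigidity.closes :
ZoomRigidity → Rigidity → SubseqLimitAxioms → JointCompactness → ZoomInvariantLimitSet →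
SAWScalingLimit`, which is proved sorry-free in the route file (rev 2, 2026-08-15): zoom rigidity
of the compact zoom-invariant set Ω_SAW of joint subsequential SAW limits gives dilation
covariance, `Rigidity` upgrades the lattice-similarity-covariant restriction–Markov families to
conformally covariant ones, the proved Literature theorem `LawlerSchrammWerner2003_holds`
identifies every element of Ω_SAW with chordal SLE_{8/3}, and the subsequence principle along
`𝓝[>] 0` (joint compactness (a) + uniqueness in law of SLE) yields the full scaling limit for every
Dobrushin domain and every endpoint approximation. This file only re-brackets the hypotheses.

Repair 2026-08-16: the route file stopped declaring `Assembly2` (gate lint autofix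
`route.multi-assembly`, 2026-08-16T14:43:07Z: duplicate assembly variants dropped, the one `closes`
uses — `Assembly`, stmt-CriticalPhenomena-6504 — kept; the proved record of stmt-8331 unchanged), so
the constant is re-declared below in the route namespace, with the item's ledger signature verbatim,
solely so that its proved record `Assembly2_proof` keeps elaborating unchanged (same device as
`Theorems/CoherentStatesAssembly2.lean` of AnomalousDissipation).
-/

namespace Summit.CriticalPhenomena.SAWScalingLimit.Theses.SAWZoomRigidity

/-- The legacy assembly variant `Assembly2` of route SAWZoomRigidity (item stmt-CriticalPhenomena-8331,
ledger name `AssemblyUnconditional`), signature verbatim: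
`(Rigidity ∧ ZoomRigidity ∧ SubseqLimitAxioms ∧ JointCompactness ∧ ZoomInvariantLimitSet) →
SAWScalingLimit` over the route's surviving item declarations. The route file stopped declaring it
on 2026-08-16 (multi-assembly autofix), so it is re-declared here, unchanged, only to keep the proved
record below elaborating (a definition, not a cited fact). -/
def Assembly2 : Prop :=
  (Rigidity ∧ ZoomRigidity ∧ SubseqLimitAxioms ∧ JointCompactness ∧ ZoomInvariantLimitSet) →
    _root_.SAWScalingLimit

end Summit.CriticalPhenomena.SAWScalingLimit.Theses.SAWZoomRigidity

namespace Summit.CriticalPhenomena.SAWScalingLimit.Theorems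

/-- **`Assembly2` holds** (item stmt-CriticalPhenomena-8331 of route SAWZoomRigidity): the
conjunction `Rigidity ∧ ZoomRigidity ∧ SubseqLimitAxioms ∧ JointCompactness ∧
ZoomInvariantLimitSet` of the route's cruxes and its zoom-invariance support implies the
sub-problem statement `SAWScalingLimit` (planar critical SAW → chordal SLE_{8/3}). Immediate from
the route's proved deciding theorem
`Summit.CriticalPhenomena.SAWScalingLimit.Theses.SAWZoomRigidity.closes`. -/
theorem Assembly2_proof :
    Summit.CriticalPhenomena.SAWScalingLimit.Theses.SAWZoomRigidity.Assembly2 := by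
  unfold Summit.CriticalPhenomena.SAWScalingLimit.Theses.SAWZoomRigidity.Assembly2
  rintro ⟨hR, hZ, hS, hJ, hZI⟩
  exact Summit.CriticalPhenomena.SAWScalingLimit.Theses.SAWZoomRigidity.closes hZ hR hS hJ hZI

end Summit.CriticalPhenomena.SAWScalingLimit.Theorems
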